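import Summits.ResolutionOfSingularities.ResolutionOfSingularities.Theorems.FrobeniusLadderFInjectiveMacaulayficationRelGddF192ConeData
import Summits.ResolutionOfSingularities.ResolutionOfSingularities.Theorems.FrobeniusLadderFInjectiveMacaulayficationRelGddF211Data
import HarnessLib

/-!
# ROWC row F211 at `p = 5`: the CONE clause OFF THE BAD ORBIT `O = {x = y = z = t = 0}` (clone of `…RelGddF192Cone`)
# (crux `FInjectiveMacaulayfication` stmt-ResolutionOfSingularities-15315, engine v2 `FilteredConeFiModelRelDirect`; RULING R16.9 (2) of
# res-L1-w45a-plan-1: «F211/5 = F192 + y⁵w, clone test of the facet template»)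

Support file, chain w45a, seat res-L1-w45a-stub-4 g6. [OURS · L1 W4.5a] — NOT a statement of the manuscript; AI-written, weaker than
expert review.

`g₀ = z² + t⁴y²w⁴ + (y² + x³)³ + y⁵w`, the `(2,3,9,3 | 0)`-cone of F211's diagonal form.  The extra term `y⁵w` SIMPLIFIES the singular
locus off `V(x,y,z,w)`: `∂_w = y²(4t⁴w³ + y³)` and `∂_t = 4t³y²w⁴` force `y ∈ P` (else `y³ ∈ P`), then `∂_x = 9x²φ²` forces `x ∈ P`; so every
non-regular closed point off `V(x,y,z,w)` lies on `{x=y=z=0}`, where `w ∉ P` (some `x̄ⱼ ∉ Q`) and, off `O`, `t ∉ P`: slices `x,y,z`,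
witness `x⁰y⁴z⁴`, coefficient `6·(t⁴w⁴)²` (`coeff_S1'`, the `y⁵w` term dies with `Y⁵`) ⇒ `FedderViaSlicing.clause_of_sliceCoeff`.
No definitions, no named facts. [folklore]
-/

-- single-problem summit: the doubled namespace component is forced
set_option linter.dupNamespace false

noncomputable section

namespace Summit.ResolutionOfSingularities.ResolutionOfSingularities.Theorems.FInjectiveMacaulayfication.RelGddF211Cone

open MvPolynomial IsLocalRing
open Summit.ResolutionOfSingularities.ResolutionOfSingularities.Theorems.FInjectiveMacaulayfication

/-- **Stratum `{x=y=z=0}` for F211's cone: the `x⁰y⁴z⁴`-coefficient of `g₀⁴` is `6·a²`, `a = t⁴w⁴`** (slices `x,y,z`; the term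
`C(b)Y⁵ = y⁵w` contributes only multiples of `Y⁵`). [folklore] -/
theorem coeff_S1' (k : Type) [Field k] (a b : MvPolynomial (Fin 2) k) :
    coeff (Finsupp.single (2 : Fin 3) (2 * 2) + Finsupp.single 1 4)
      ((X 2 ^ 2 + (C a * X 1 ^ 2 + (X 1 ^ 2 + X 0 ^ 3) ^ 3 + C b * X 1 ^ 5) : MvPolynomial (Fin 3) (MvPolynomial (Fin 2) k)) ^ 4) =
        6 * a ^ 2 := by
  set u : MvPolynomial (Fin 3) (MvPolynomial (Fin 2) k) := C a * X 1 ^ 2 + (X 1 ^ 2 + X 0 ^ 3) ^ 3 + C b * X 1 ^ 5 with hu_def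
  have hXdeg : ∀ (j : Fin 3), j ≠ 2 → ∀ n : ℕ, degreeOf 2 (X j ^ n : MvPolynomial (Fin 3) (MvPolynomial (Fin 2) k)) = 0 := by
    intro j hj n
    apply Nat.eq_zero_of_le_zero
    refine (degreeOf_pow_le _ _ _).trans ?_
    rw [degreeOf_X, if_neg hj.symm, mul_zero]
  have hφdeg : degreeOf 2 (X 1 ^ 2 + X 0 ^ 3 : MvPolynomial (Fin 3) (MvPolynomial (Fin 2) k)) = 0 := by
    apply Nat.eq_zero_of_le_zero
    refine (degreeOf_add_le _ _ _).trans (max_le ?_ ?_)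
    · rw [hXdeg 1 (by decide)]
    · rw [hXdeg 0 (by decide)]
  have hu : degreeOf 2 u = 0 := by
    apply Nat.eq_zero_of_le_zero
    refine (degreeOf_add_le _ _ _).trans (max_le ((degreeOf_add_le _ _ _).trans (max_le ?_ ?_)) ?_)
    · refine (degreeOf_mul_le _ _ _).trans ?_
      rw [degreeOf_C, hXdeg 1 (by decide)]
    · refine (degreeOf_pow_le _ _ _).trans ?_
      rw [hφdeg, mul_zero]
    · refine (degreeOf_mul_le _ _ _).trans ?_
      rw [degreeOf_C, hXdeg 1 (by decide)]
  rw [FedderViaSlicing.coeff_X_pow_add_pow 2 2 4 2 (by norm_num) (by norm_num) u hu _ (by simp),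
    show (4 - 2 : ℕ) = 2 from rfl, show (Nat.choose 4 2 : MvPolynomial (Fin 2) k) = 6 by norm_num [Nat.choose]]
  congr 1
  have hdvd : (X 0 : MvPolynomial (Fin 3) (MvPolynomial (Fin 2) k)) ^ 1 ∣ u - (C a * X 1 ^ 2 + X 1 ^ 6 + C b * X 1 ^ 5) :=
    ⟨X 0 ^ 2 * (3 * X 1 ^ 4 + 3 * X 1 ^ 2 * X 0 ^ 3 + X 0 ^ 6), by rw [hu_def]; ring⟩
  rw [T4PlusFedderData.coeff_pow_eq_of_X_pow_dvd_sub (Finsupp.single 1 4) 0 1 (by simp) hdvd 2]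
  have hsq : ((C a * X 1 ^ 2 + X 1 ^ 6 + C b * X 1 ^ 5) ^ 2 : MvPolynomial (Fin 3) (MvPolynomial (Fin 2) k)) =
      C (a ^ 2) * X 1 ^ 4 + X 1 ^ 5 * (2 * C a * X 1 ^ 3 + X 1 ^ 7 + 2 * C a * C b * X 1 ^ 2 + 2 * C b * X 1 ^ 6 + C b * C b * X 1 ^ 5) := by
    rw [map_pow]; ring
  rw [hsq, coeff_add, HFedderCertificates.coeff_X_pow_mul_eq_zero _ 1 5 (by simp), add_zero, X_pow_eq_monomial, coeff_C_mul,
    coeff_monomial, if_pos rfl, mul_one]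

set_option maxHeartbeats 400000 in
/-- **THE CONE CLAUSE OFF THE BAD ORBIT for `g₀ = z² + t⁴y²w⁴ + (y² + x³)³ + y⁵w` at `p = 5`** (F211): at every maximal ideal `Q`
of `k[X]/(g₀)` missing some `x̄ⱼ` (`j ≤ 3`) and not containing all of `x̄₀, x̄₁, x̄₂, x̄₄`, the local ring satisfies the
Cohen–Macaulay + Frobenius-closed clause. [cite: Fedder1983, Thm. 1.12] [cite: Matsumura1987, Thm. 30.4 (ii)] -/
theorem g0_offO_clause_char5 (k : Type) [Field k] [CharP k 5] (g₀ : MvPolynomial (Fin 5) k)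
    (hg : g₀ = X 2 ^ 2 + X 4 ^ 4 * X 1 ^ 2 * X 3 ^ 4 + (X 1 ^ 2 + X 0 ^ 3) ^ 3 + X 1 ^ 5 * X 3) :
    ∀ (Q : Ideal (MvPolynomial (Fin 5) k ⧸ Ideal.span {g₀})) [Q.IsMaximal],
      (∃ j ∈ ({0, 1, 2, 3} : Finset (Fin 5)), Ideal.Quotient.mk (Ideal.span {g₀}) (MvPolynomial.X j) ∉ Q) →
      ¬ (Ideal.Quotient.mk (Ideal.span {g₀}) (MvPolynomial.X 0) ∈ Q ∧ Ideal.Quotient.mk (Ideal.span {g₀}) (MvPolynomial.X 1) ∈ Q ∧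
         Ideal.Quotient.mk (Ideal.span {g₀}) (MvPolynomial.X 2) ∈ Q ∧ Ideal.Quotient.mk (Ideal.span {g₀}) (MvPolynomial.X 4) ∈ Q) →
      ∀ d : ℕ, ringKrullDim (Localization.AtPrime Q) = d → ∀ s : Fin d → Localization.AtPrime Q,
        (Ideal.span (Set.range s)).radical.IsMaximal →
          RingTheory.Sequence.IsWeaklyRegular (Localization.AtPrime Q) (List.ofFn s) ∧
          ∀ y : Localization.AtPrime Q, (∃ e : ℕ, y ^ 5 ^ e ∈ Ideal.span
            ((fun z : Localization.AtPrime Q => z ^ 5 ^ e) ''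
              (Ideal.span (Set.range s) : Set (Localization.AtPrime Q)))) → y ∈ Ideal.span (Set.range s) := by
  haveI : Fact (Nat.Prime 5) := ⟨by norm_num⟩
  intro Q _ hj hO d hd s hs
  haveI hPmax : (Q.comap (Ideal.Quotient.mk (Ideal.span {g₀}))).IsMaximal :=
    Ideal.comap_isMaximal_of_surjective _ Ideal.Quotient.mk_surjective
  have hP := hPmax.isPrime
  have hg0 : g₀ ≠ 0 := hg ▸ RelGddF211Data.g0_ne_zero k
  -- units in characteristic `5`
  have hu2 : IsUnit (2 : MvPolynomial (Fin 5) k) := by simpa using G5wConeClause.isUnit_natCast_of_not_dvd 5 k 2 (by decide)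
  have hu4 : IsUnit (4 : MvPolynomial (Fin 5) k) := by simpa using G5wConeClause.isUnit_natCast_of_not_dvd 5 k 4 (by decide)
  have hu9 : IsUnit (9 : MvPolynomial (Fin 5) k) := by simpa using G5wConeClause.isUnit_natCast_of_not_dvd 5 k 9 (by decide)
  -- partial derivatives
  have hd0 : pderiv 0 g₀ = 9 * X 0 ^ 2 * (X 1 ^ 2 + X 0 ^ 3) ^ 2 := by rw [hg, RelGddF211Data.pderiv_zero_g0]
  have hd2 : pderiv 2 g₀ = 2 * X 2 := by rw [hg, RelGddF211Data.pderiv_two_g0]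
  have hd3 : pderiv 3 g₀ = 4 * X 4 ^ 4 * X 1 ^ 2 * X 3 ^ 3 + X 1 ^ 5 := by rw [hg, RelGddF211Data.pderiv_three_g0]
  have hd4 : pderiv 4 g₀ = 4 * X 4 ^ 3 * X 1 ^ 2 * X 3 ^ 4 := by rw [hg, RelGddF211Data.pderiv_four_g0]
  -- Jacobian exits
  by_cases m2 : pderiv 2 g₀ ∈ Q.comap (Ideal.Quotient.mk (Ideal.span {g₀})); swap
  · exact ClauseOfPderivNotMem.stub_clauseOfPderivNotMem 5 k 5 g₀ Q 2 m2 d hd s hs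
  by_cases m0 : pderiv 0 g₀ ∈ Q.comap (Ideal.Quotient.mk (Ideal.span {g₀})); swap
  · exact ClauseOfPderivNotMem.stub_clauseOfPderivNotMem 5 k 5 g₀ Q 0 m0 d hd s hs
  by_cases m3 : pderiv 3 g₀ ∈ Q.comap (Ideal.Quotient.mk (Ideal.span {g₀})); swap
  · exact ClauseOfPderivNotMem.stub_clauseOfPderivNotMem 5 k 5 g₀ Q 3 m3 d hd s hs
  by_cases m4 : pderiv 4 g₀ ∈ Q.comap (Ideal.Quotient.mk (Ideal.span {g₀})); swap
  · exact ClauseOfPderivNotMem.stub_clauseOfPderivNotMem 5 k 5 g₀ Q 4 m4 d hd s hs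
  rw [hd2] at m2
  rw [hd0, mul_assoc] at m0
  rw [hd3] at m3
  rw [hd4, mul_assoc, mul_assoc] at m4
  have hX2 : (X 2 : MvPolynomial (Fin 5) k) ∈ Q.comap (Ideal.Quotient.mk (Ideal.span {g₀})) :=
    (Ideal.unit_mul_mem_iff_mem _ hu2).mp m2
  have key : ∀ i : Fin 5, (X i : MvPolynomial (Fin 5) k) ∈ Q.comap (Ideal.Quotient.mk (Ideal.span {g₀})) ↔
      Ideal.Quotient.mk (Ideal.span {g₀}) (X i) ∈ Q := fun i => Ideal.mem_comap
  -- `y ∈ P`: otherwise `∂_w = y²(4t⁴w³ + y³)` and `∂_t` give `y³ ∈ P`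
  have hX1 : (X 1 : MvPolynomial (Fin 5) k) ∈ Q.comap (Ideal.Quotient.mk (Ideal.span {g₀})) := by
    by_contra hX1
    have h1 : (X 1 ^ 2 * (4 * X 4 ^ 4 * X 3 ^ 3 + X 1 ^ 3) : MvPolynomial (Fin 5) k) ∈ Q.comap (Ideal.Quotient.mk (Ideal.span {g₀})) := by
      have e : (X 1 ^ 2 * (4 * X 4 ^ 4 * X 3 ^ 3 + X 1 ^ 3) : MvPolynomial (Fin 5) k) = 4 * X 4 ^ 4 * X 1 ^ 2 * X 3 ^ 3 + X 1 ^ 5 := by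
        ring
      rw [e]; exact m3
    have h2 : (4 * X 4 ^ 4 * X 3 ^ 3 + X 1 ^ 3 : MvPolynomial (Fin 5) k) ∈ Q.comap (Ideal.Quotient.mk (Ideal.span {g₀})) := by
      rcases hP.mem_or_mem h1 with h | h
      · exact absurd (hP.mem_of_pow_mem 2 h) hX1
      · exact h
    have h3 : (X 1 ^ 3 : MvPolynomial (Fin 5) k) ∈ Q.comap (Ideal.Quotient.mk (Ideal.span {g₀})) := by
      rcases hP.mem_or_mem ((Ideal.unit_mul_mem_iff_mem _ hu4).mp m4) with h | h
      · have ht : (X 4 : MvPolynomial (Fin 5) k) ∈ Q.comap (Ideal.Quotient.mk (Ideal.span {g₀})) := hP.mem_of_pow_mem 3 h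
        have e : (X 1 ^ 3 : MvPolynomial (Fin 5) k) = (4 * X 4 ^ 4 * X 3 ^ 3 + X 1 ^ 3) - X 4 * (4 * X 4 ^ 3 * X 3 ^ 3) := by ring
        rw [e]; exact Ideal.sub_mem _ h2 (Ideal.mul_mem_right _ _ ht)
      · rcases hP.mem_or_mem h with h' | h'
        · exact absurd (hP.mem_of_pow_mem 2 h') hX1
        · have hw : (X 3 : MvPolynomial (Fin 5) k) ∈ Q.comap (Ideal.Quotient.mk (Ideal.span {g₀})) := hP.mem_of_pow_mem 4 h'
          have e : (X 1 ^ 3 : MvPolynomial (Fin 5) k) = (4 * X 4 ^ 4 * X 3 ^ 3 + X 1 ^ 3) - X 3 * (4 * X 4 ^ 4 * X 3 ^ 2) := by ring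
          rw [e]; exact Ideal.sub_mem _ h2 (Ideal.mul_mem_right _ _ hw)
    exact hX1 (hP.mem_of_pow_mem 3 h3)
  -- `x ∈ P`: `∂_x = 9x²φ²`, and `φ ∈ P` with `y ∈ P` gives `x³ ∈ P`
  have hX0 : (X 0 : MvPolynomial (Fin 5) k) ∈ Q.comap (Ideal.Quotient.mk (Ideal.span {g₀})) := by
    rcases hP.mem_or_mem ((Ideal.unit_mul_mem_iff_mem _ hu9).mp m0) with h | h
    · exact hP.mem_of_pow_mem 2 h
    · have hφ := hP.mem_of_pow_mem 2 h
      refine hP.mem_of_pow_mem 3 ?_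
      have e : (X 0 ^ 3 : MvPolynomial (Fin 5) k) = (X 1 ^ 2 + X 0 ^ 3) - X 1 * X 1 := by ring
      rw [e]; exact Ideal.sub_mem _ hφ (Ideal.mul_mem_left _ _ hX1)
  -- `w ∉ P` (some `x̄ⱼ ∉ Q`) and `t ∉ P` (off `O`)
  have hX3 : (X 3 : MvPolynomial (Fin 5) k) ∉ Q.comap (Ideal.Quotient.mk (Ideal.span {g₀})) := by
    intro h3
    obtain ⟨j, hjJ, hjQ⟩ := hj
    apply hjQ
    simp only [Finset.mem_insert, Finset.mem_singleton] at hjJ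
    rcases hjJ with rfl | rfl | rfl | rfl
    · exact (key 0).mp hX0
    · exact (key 1).mp hX1
    · exact (key 2).mp hX2
    · exact (key 3).mp h3
  have hX4 : (X 4 : MvPolynomial (Fin 5) k) ∉ Q.comap (Ideal.Quotient.mk (Ideal.span {g₀})) :=
    fun h4 => hO ⟨(key 0).mp hX0, (key 1).mp hX1, (key 2).mp hX2, (key 4).mp h4⟩
  -- stratum `{x=y=z=0}`: slices `x,y,z`, witness `y⁴z⁴`, coefficient `6(t⁴w⁴)²`
  obtain ⟨Ψ, hΨ0, hΨ1, hΨ2, hΨ3, hΨ4⟩ := RelGddF192ConeData.exists_xyzSlicing5 k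
  have hy0 : Ψ.symm (X 0) = X 0 := Ψ.symm_apply_eq.mpr hΨ0.symm
  have hy1 : Ψ.symm (X 1) = X 1 := Ψ.symm_apply_eq.mpr hΨ1.symm
  have hy2 : Ψ.symm (X 2) = X 2 := Ψ.symm_apply_eq.mpr hΨ2.symm
  have hb0 : Ψ.symm (C (X 0)) = X 3 := Ψ.symm_apply_eq.mpr hΨ3.symm
  have hb1 : Ψ.symm (C (X 1)) = X 4 := Ψ.symm_apply_eq.mpr hΨ4.symm
  have hy : ∀ r : Fin 3, Ψ.symm (X r) ∈ Q.comap (Ideal.Quotient.mk (Ideal.span {g₀})) := by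
    intro r; fin_cases r
    · exact hy0 ▸ hX0
    · exact hy1 ▸ hX1
    · exact hy2 ▸ hX2
  have hΨg : Ψ g₀ = X 2 ^ 2 + (C (X 1 ^ 4 * X 0 ^ 4) * X 1 ^ 2 + (X 1 ^ 2 + X 0 ^ 3) ^ 3 + C (X 0) * X 1 ^ 5) := by
    rw [hg]; simp only [map_add, map_mul, map_pow, hΨ0, hΨ1, hΨ2, hΨ3, hΨ4]; ring
  have hcoeff : coeff (Finsupp.single (2 : Fin 3) (2 * 2) + Finsupp.single 1 4) (Ψ (g₀ ^ (5 - 1))) =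
      6 * (X 1 ^ 4 * X 0 ^ 4) ^ 2 := by
    rw [map_pow, hΨg, show (5 - 1 : ℕ) = 4 from rfl, coeff_S1']
  have hu : IsUnit (6 : MvPolynomial (Fin 2) k) := by simpa using G5wConeClause.isUnit_natCast_of_not_dvd 5 k 6 (by decide)
  have hdslice : ∀ r : Fin 3, (Finsupp.single (2 : Fin 3) (2 * 2) + Finsupp.single 1 4 : Fin 3 →₀ ℕ) r < 5 := by
    intro r; fin_cases r <;> simp
  haveI h𝔭 : ((Q.comap (Ideal.Quotient.mk (Ideal.span {g₀}))).comap (Ψ.symm.toRingHom.comp C)).IsPrime := Ideal.comap_isPrime _ _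
  have htw : (X 1 ^ 4 * X 0 ^ 4 : MvPolynomial (Fin 2) k) ∉
      (Q.comap (Ideal.Quotient.mk (Ideal.span {g₀}))).comap (Ψ.symm.toRingHom.comp C) := by
    intro h
    rcases h𝔭.mem_or_mem h with h1 | h0
    · have h1' := Ideal.mem_comap.mp (h𝔭.mem_of_pow_mem 4 h1)
      rw [RingHom.comp_apply, RingEquiv.toRingHom_eq_coe, RingEquiv.coe_toRingHom, hb1] at h1'
      exact hX4 h1'
    · have h0' := Ideal.mem_comap.mp (h𝔭.mem_of_pow_mem 4 h0)
      rw [RingHom.comp_apply, RingEquiv.toRingHom_eq_coe, RingEquiv.coe_toRingHom, hb0] at h0'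
      exact hX3 h0'
  exact FedderViaSlicing.clause_of_sliceCoeff 5 k Ψ g₀ hg0 Q hy _ hdslice _ (X 1 ^ 4 * X 0 ^ 4) hu 2 (by norm_num) hcoeff
    (Or.inl htw) d hd s hs

end Summit.ResolutionOfSingularities.ResolutionOfSingularities.Theorems.FInjectiveMacaulayfication.RelGddF211Cone

end
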